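import Summits.ResolutionOfSingularities.ResolutionOfSingularities.Theorems.EquisingularLiftEquisingularLiftNatCompleteIntersectionLiftAlgebra
import Literature.AlgebraicGeometry.Resolution.ProjHomogeneousIdealSheaf
import Literature.AlgebraicGeometry.Motives.VarietiesProjectiveSpaceProofs
import Mathlib.AlgebraicGeometry.ProjectiveSpectrum.Basic
import Mathlib.Algebra.MvPolynomial.PDeriv
import Mathlib.RingTheory.MvPolynomial.Homogeneous
import HarnessLib

/-!
# [OURS · L1 W4.5(b) · EL♮(3)] T-LIFT-CI, brick CI-JAC: the JACOBIAN-MINOR clause of `stub_elnat_ciNoseThenPoints` gives the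
# stalk-level «downstairs hypothesis» (J′) at every point of `Σ`, on every standard chart containing it

Cell `res-hironaka`, rung L, slot W4.5(b); crux **EL♮(3)** (stmt-ResolutionOfSingularities-20148), registered stub
`stub_elnat_ciNoseThenPoints` (res-L1-w45b-lead-2 RESHAPE v6, 2026-08-27T08:54:27Z); cut (L1) T-LIFT-CI of res-D-pv-027 AS
res-L1-s36-pv-4, brick «(J) ⇒ (J′)» offered 2026-08-27T09:13:22Z, taken by res-type-051 (g14). OURS; NOT a statement of any manuscript;
AI-written, weaker than expert review. No definition, no `sorry`, standard axioms. `--supports stmt-ResolutionOfSingularities-20148 --as helper`.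

(J) = the stub's clause at `y ∈ Σ`: `∃ e : Fin c ↪ Fin (n+1)`, `det (∂f_i/∂x_{e j}) ∉ 𝔮_y`. (J′) = what `CILift.isRegular_and_flat_of_cotangentLift`
eats downstairs (via `CILift.downstairs_of_surjective` along the stalk map of `ℙⁿ_k → ℙⁿ_O`): in `A = 𝒪_{ℙⁿ_k, y}`, for the germs
`g_l` of the sections `f_l / x_i^{d_l}` on a chart `D₊(x_i) ∋ y`, «`Σ b_l g_l ∈ 𝔪_A²` forces every `b_l ∈ 𝔪_A`».

ROUTE (no dehomogenisation, no Euler exchange): `𝒪_{ℙⁿ_k,y} ≅ (k[x]_𝔮)₀` (Mathlib `Proj.stalkIso'`, `awayToSection_germ`), a subring of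
`L = k[x₀..xₙ]_𝔮` detecting units (`HomogeneousLocalization.isUnit_iff_isUnit_val`); in `L` the HOMOGENEOUS partials `∂/∂x_{e j}` are
derivations of `k[x₀..xₙ]` with `det (∂_{e j} f_i) ∉ 𝔮`, so res-D-pv-027's P1 `CILift.downstairs_of_jacobian` (Matsumura 30.4 (ii) key step)
applies to `f_l ∈ 𝔮`; the denominators `x_i^{d_l}` are units of `L`. Hence (J′) holds on EVERY chart `D₊(x_i)` containing `y`.

* `CILift.downstairs_atPrime_of_jacobian` — the core, in `B = HomogeneousLocalization.AtPrime 𝒜 𝔮` for elements `m_l` with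
  `m_l · x_i^{d_l} = f_l` in `L` (spelling-agnostic: any degree-0 fractions with these values);
* `CILift.downstairs_stalk_of_jacobian` — (J′) in `𝒪_{ℙⁿ_k,y}` for the germs of `awayToSection (mk₁ (f_l / x_i^{d_l}))`, ANY chart `i` with
  `y ∈ D₊(x_i)` (res-D-pv-027's p518108 germ spelling);
* `CILift.downstairs_of_jacobianMinor` — the `∃ i` form = res-D-pv-027's (J′) verbatim (a chart containing `y` exists since `𝔮_y` is relevant).

References: H. Matsumura, *Commutative Ring Theory* (1986; CUP paperback 1989), Thm. 30.4 [Matsumura1987]; R. Hartshorne, *Algebraic Geometry* (1977), II Prop. 5.9,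
proof of II.2.5 [Hartshorne1977]; cell: res-D-pv-027 PACE #2 2026-08-27T09:13:22Z (interface (J′)), p517176 (P1).
-/

set_option linter.dupNamespace false -- mandated namespace `Summit.<Summit>.<Problem>` of this single-conjunct summit

noncomputable section

open CategoryTheory AlgebraicGeometry TopologicalSpace IsLocalRing
open MvPolynomial HomogeneousLocalization
open Literature.AlgebraicGeometry.Resolution

attribute [local instance] MvPolynomial.gradedAlgebra

namespace Summit.ResolutionOfSingularities.ResolutionOfSingularities.Cruxes.EquisingularLiftNat.Sections

namespace CILift

/-! ## The core, in the homogeneous localization `(k[x]_𝔮)₀ ⊆ k[x]_𝔮` -/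

section AtPrime

variable {k : Type} [Field k] {n c : ℕ}

/-- The variables are homogeneous of degree one (local copy of the p518108 lemma, to keep this file independent of it). [folklore] -/
theorem X_mem_one'' (i : Fin (n + 1)) : (X i : MvPolynomial (Fin (n + 1)) k) ∈ homogeneousSubmodule (Fin (n + 1)) k 1 :=
  isHomogeneous_X k i

/-- **CI-JAC, core.** `k` a field, `f₁,…,f_c ∈ k[x₀..xₙ]`, `𝔮` a prime containing the `f_l`, and a `c × c` Jacobian minor
`det (∂f_i/∂x_{e j})` NOT in `𝔮`. Then in the local ring `B = (k[x]_𝔮)₀` (homogeneous localization at `𝔮`), for any elements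
`m_l ∈ B` with `m_l · s_l = f_l` in `L = k[x]_𝔮` for some `s_l ∉ 𝔮` (e.g. `m_l = f_l / x_i^{d_l}`): `Σ b_l m_l ∈ 𝔪_B²` forces every
`b_l ∈ 𝔪_B`. PROOF: push to `L` (`B → L` detects units), absorb the units `s_l⁻¹` into the coefficients, and apply
`CILift.downstairs_of_jacobian` with the homogeneous partial derivations `∂/∂x_{e j}`. [cite: Matsumura1987, Thm. 30.4 (ii)] -/
theorem downstairs_atPrime_of_jacobian (f : Fin c → MvPolynomial (Fin (n + 1)) k)
    (𝔮 : Ideal (MvPolynomial (Fin (n + 1)) k)) [𝔮.IsPrime] (hy : ∀ l, f l ∈ 𝔮) (e : Fin c ↪ Fin (n + 1))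
    (hdet : (Matrix.of fun i j => pderiv (e j) (f i)).det ∉ 𝔮)
    (s : Fin c → MvPolynomial (Fin (n + 1)) k) (hs : ∀ l, s l ∉ 𝔮)
    (m : Fin c → HomogeneousLocalization.AtPrime (homogeneousSubmodule (Fin (n + 1)) k) 𝔮)
    (hm : ∀ l, (m l).val * algebraMap (MvPolynomial (Fin (n + 1)) k) (Localization.AtPrime 𝔮) (s l) =
      algebraMap (MvPolynomial (Fin (n + 1)) k) (Localization.AtPrime 𝔮) (f l)) :
    ∀ b : Fin c → HomogeneousLocalization.AtPrime (homogeneousSubmodule (Fin (n + 1)) k) 𝔮,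
      ∑ l, b l * m l ∈ maximalIdeal (HomogeneousLocalization.AtPrime (homogeneousSubmodule (Fin (n + 1)) k) 𝔮) ^ 2 →
      ∀ l, b l ∈ maximalIdeal (HomogeneousLocalization.AtPrime (homogeneousSubmodule (Fin (n + 1)) k) 𝔮) := by
  classical
  intro b hb l
  -- the homogeneous partials as `ℤ`-derivations and the transposed Jacobian minor
  let D : Fin c → Derivation ℤ (MvPolynomial (Fin (n + 1)) k) (MvPolynomial (Fin (n + 1)) k) :=
    fun j => (pderiv (e j)).restrictScalars ℤ
  have hdet' : (Matrix.of fun i j => D i (f j)).det ∉ 𝔮 := by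
    have hT : (Matrix.of fun i j => D i (f j)) = (Matrix.of fun i j => pderiv (e j) (f i)).transpose := by
      ext i j
      rfl
    rw [hT, Matrix.det_transpose]
    exact hdet
  have key := downstairs_of_jacobian 𝔮 (Localization.AtPrime 𝔮) D f hy hdet'
  -- `B → L` detects units, so it maps `𝔪_B` into `𝔪_L` and `𝔪_B²` into `𝔪_L²`
  have hval : ∀ z : HomogeneousLocalization.AtPrime (homogeneousSubmodule (Fin (n + 1)) k) 𝔮, z ∈ maximalIdeal (HomogeneousLocalization.AtPrime (homogeneousSubmodule (Fin (n + 1)) k) 𝔮) → z.val ∈ maximalIdeal (Localization.AtPrime 𝔮) := by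
    intro z hz
    rw [mem_maximalIdeal, mem_nonunits_iff] at hz ⊢
    exact fun hu => hz ((isUnit_iff_isUnit_val _ _ z).mp hu)
  have hval2 : ∀ z : HomogeneousLocalization.AtPrime (homogeneousSubmodule (Fin (n + 1)) k) 𝔮, z ∈ maximalIdeal (HomogeneousLocalization.AtPrime (homogeneousSubmodule (Fin (n + 1)) k) 𝔮) ^ 2 → z.val ∈ maximalIdeal (Localization.AtPrime 𝔮) ^ 2 := by
    intro z hz
    have hle : maximalIdeal (HomogeneousLocalization.AtPrime (homogeneousSubmodule (Fin (n + 1)) k) 𝔮) ≤ (maximalIdeal (Localization.AtPrime 𝔮)).comap (algebraMap (HomogeneousLocalization.AtPrime (homogeneousSubmodule (Fin (n + 1)) k) 𝔮) (Localization.AtPrime 𝔮)) :=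
      fun x hx => hval x hx
    have h1 : z ∈ (maximalIdeal (Localization.AtPrime 𝔮)).comap (algebraMap (HomogeneousLocalization.AtPrime (homogeneousSubmodule (Fin (n + 1)) k) 𝔮) (Localization.AtPrime 𝔮)) ^ 2 := Ideal.pow_right_mono hle 2 hz
    have h2 : z ∈ (maximalIdeal (Localization.AtPrime 𝔮) ^ 2).comap (algebraMap (HomogeneousLocalization.AtPrime (homogeneousSubmodule (Fin (n + 1)) k) 𝔮) (Localization.AtPrime 𝔮)) := Ideal.le_comap_pow _ 2 h1
    rwa [Ideal.mem_comap, HomogeneousLocalization.algebraMap_apply] at h2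
  -- the units `s_l⁻¹`
  have hsu : ∀ l, IsUnit (algebraMap (MvPolynomial (Fin (n + 1)) k) (Localization.AtPrime 𝔮) (s l)) :=
    fun l => IsLocalization.map_units (Localization.AtPrime 𝔮) ⟨s l, show s l ∈ 𝔮.primeCompl from hs l⟩
  let w : Fin c → Localization.AtPrime 𝔮 := fun l => ((hsu l).unit⁻¹ : (Localization.AtPrime 𝔮)ˣ)
  have hw : ∀ l, algebraMap (MvPolynomial (Fin (n + 1)) k) (Localization.AtPrime 𝔮) (s l) * w l = 1 := fun l => (hsu l).mul_val_inv
  have hmw : ∀ l, (m l).val = algebraMap (MvPolynomial (Fin (n + 1)) k) (Localization.AtPrime 𝔮) (f l) * w l := by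
    intro l
    rw [← hm l, mul_assoc, hw l, mul_one]
  -- push the relation to `L`
  have hbL : ∑ j, ((b j).val * w j) * algebraMap (MvPolynomial (Fin (n + 1)) k) (Localization.AtPrime 𝔮) (f j) ∈ maximalIdeal (Localization.AtPrime 𝔮) ^ 2 := by
    have h := hval2 _ hb
    have hsum : (∑ j, b j * m j).val = ∑ j, ((b j).val * w j) * algebraMap (MvPolynomial (Fin (n + 1)) k) (Localization.AtPrime 𝔮) (f j) := by
      rw [← HomogeneousLocalization.algebraMap_apply, map_sum]
      refine Finset.sum_congr rfl fun j _ => ?_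
      rw [map_mul, HomogeneousLocalization.algebraMap_apply, HomogeneousLocalization.algebraMap_apply, hmw j]
      ring
    rwa [hsum] at h
  have hbl : (b l).val * w l ∈ maximalIdeal (Localization.AtPrime 𝔮) := key _ hbL l
  -- back to `B`
  rw [mem_maximalIdeal, mem_nonunits_iff]
  intro hu
  have hu' : IsUnit ((b l).val * w l) := ((isUnit_iff_isUnit_val _ _ (b l)).mpr hu).mul (Units.isUnit _)
  exact (mem_maximalIdeal _ |>.mp hbl) hu'

end AtPrime

/-! ## (J′) in the stalk `𝒪_{ℙⁿ_k, y}` -/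

section Stalk

variable {k : Type} [Field k] {n c : ℕ}

/-- **The germ of `f / x_iᵈ` at `y`, read in `(k[x]_𝔮)₀ ⊆ k[x]_𝔮`**: under Mathlib's `Proj.stalkIso'`, the germ at `y ∈ D₊(x_i)` of the
section `awayToSection (mk₁ (f / x_iᵈ))` is the fraction with numerator `f` and denominator `x_iᵈ` (`awayToSection_germ`), so its
value `v` in `k[x]_𝔮` satisfies `v · x_iᵈ = f`. [cite: Hartshorne1977, II Prop. 5.9 (proof)] -/
theorem val_stalkIso'_germ_awayToSection_mk₁ (i : Fin (n + 1)) (y : Proj (homogeneousSubmodule (Fin (n + 1)) k))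
    (hyi : y ∈ Proj.basicOpen (homogeneousSubmodule (Fin (n + 1)) k) (X i)) (dl : ℕ) (fl : MvPolynomial (Fin (n + 1)) k)
    (hfl : fl ∈ homogeneousSubmodule (Fin (n + 1)) k dl) :
    (Proj.stalkIso' (homogeneousSubmodule (Fin (n + 1)) k) y
        (((Proj (homogeneousSubmodule (Fin (n + 1)) k)).presheaf.germ
            (Proj.basicOpen (homogeneousSubmodule (Fin (n + 1)) k) (X i)) y hyi).hom
          ((Proj.awayToSection (homogeneousSubmodule (Fin (n + 1)) k) (X i)).hom
            (mk₁ (homogeneousSubmodule (Fin (n + 1)) k) (X_mem_one'' i) dl fl hfl)))).val *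
        algebraMap (MvPolynomial (Fin (n + 1)) k) (Localization.AtPrime y.asHomogeneousIdeal.toIdeal) (X i ^ dl) =
      algebraMap (MvPolynomial (Fin (n + 1)) k) (Localization.AtPrime y.asHomogeneousIdeal.toIdeal) fl := by
  have h := congrArg (fun ψ => ψ.hom (mk₁ (homogeneousSubmodule (Fin (n + 1)) k) (X_mem_one'' i) dl fl hfl))
    (ProjectiveSpectrum.Proj.awayToSection_germ (homogeneousSubmodule (Fin (n + 1)) k) (X i) y hyi)
  simp only [CommRingCat.hom_comp, RingHom.comp_apply, CommRingCat.hom_ofHom] at h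
  change (Proj.stalkIso' (homogeneousSubmodule (Fin (n + 1)) k) y
      (((ProjectiveSpectrum.Proj.awayToSection (homogeneousSubmodule (Fin (n + 1)) k) (X i)) ≫
        (ProjectiveSpectrum.Proj.structureSheaf (homogeneousSubmodule (Fin (n + 1)) k)).presheaf.germ _ y hyi).hom
          (mk₁ (homogeneousSubmodule (Fin (n + 1)) k) (X_mem_one'' i) dl fl hfl))).val * _ = _
  rw [ProjectiveSpectrum.Proj.awayToSection_germ]
  change (Proj.stalkIso' (homogeneousSubmodule (Fin (n + 1)) k) y
      ((Proj.stalkIso' (homogeneousSubmodule (Fin (n + 1)) k) y).toCommRingCatIso.inv.hom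
        (HomogeneousLocalization.mapId (homogeneousSubmodule (Fin (n + 1)) k) (Submonoid.powers_le.mpr hyi)
          (mk₁ (homogeneousSubmodule (Fin (n + 1)) k) (X_mem_one'' i) dl fl hfl)))).val * _ = _
  have hinv : ∀ z, Proj.stalkIso' (homogeneousSubmodule (Fin (n + 1)) k) y
      ((Proj.stalkIso' (homogeneousSubmodule (Fin (n + 1)) k) y).toCommRingCatIso.inv.hom z) = z :=
    fun z => (Proj.stalkIso' (homogeneousSubmodule (Fin (n + 1)) k) y).apply_symm_apply z
  rw [hinv, mk₁, HomogeneousLocalization.Away.mk, HomogeneousLocalization.map_mk, HomogeneousLocalization.val_mk,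
    Localization.mk_eq_mk']
  exact IsLocalization.mk'_spec _ _ _

/-- **CI-JAC (J′), on any standard chart containing `y`.** `k` a field, `f₁,…,f_c ∈ k[x₀..xₙ]` homogeneous of degrees `d_l`,
`y ∈ ℙⁿ_k` with all `f_l ∈ 𝔮_y` and a Jacobian minor `det (∂f_i/∂x_{e j}) ∉ 𝔮_y`, `i` with `y ∈ D₊(x_i)`. Then in `A = 𝒪_{ℙⁿ_k,y}`, for the
germs `g_l` of the sections `f_l / x_i^{d_l}`: `Σ b_l g_l ∈ 𝔪_A²` forces every `b_l ∈ 𝔪_A` (the `g_l` are part of a regular system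
of parameters). PROOF: transport to `(k[x]_𝔮)₀` by `Proj.stalkIso'` and use `downstairs_atPrime_of_jacobian`.
[cite: Matsumura1987, Thm. 30.4 (ii)] -/
theorem downstairs_stalk_of_jacobian (f : Fin c → MvPolynomial (Fin (n + 1)) k) (d : Fin c → ℕ)
    (hf : ∀ l, f l ∈ homogeneousSubmodule (Fin (n + 1)) k (d l)) (y : Proj (homogeneousSubmodule (Fin (n + 1)) k))
    (hy : ∀ l, f l ∈ y.asHomogeneousIdeal)
    (hjac : ∃ e : Fin c ↪ Fin (n + 1), (Matrix.of fun i j => pderiv (e j) (f i)).det ∉ y.asHomogeneousIdeal)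
    (i : Fin (n + 1)) (hyi : y ∈ Proj.basicOpen (homogeneousSubmodule (Fin (n + 1)) k) (X i)) :
    ∀ b : Fin c → (Proj (homogeneousSubmodule (Fin (n + 1)) k)).presheaf.stalk y,
      ∑ l, b l * ((Proj (homogeneousSubmodule (Fin (n + 1)) k)).presheaf.germ
            (Proj.basicOpen (homogeneousSubmodule (Fin (n + 1)) k) (X i)) y hyi).hom
          ((Proj.awayToSection (homogeneousSubmodule (Fin (n + 1)) k) (X i)).hom
            (mk₁ (homogeneousSubmodule (Fin (n + 1)) k) (X_mem_one'' i) (d l) (f l) (hf l))) ∈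
        maximalIdeal ((Proj (homogeneousSubmodule (Fin (n + 1)) k)).presheaf.stalk y) ^ 2 →
      ∀ l, b l ∈ maximalIdeal ((Proj (homogeneousSubmodule (Fin (n + 1)) k)).presheaf.stalk y) := by
  classical
  intro b hb l
  obtain ⟨e, hdet⟩ := hjac
  haveI : y.asHomogeneousIdeal.toIdeal.IsPrime := y.isPrime
  let ε : ((Proj (homogeneousSubmodule (Fin (n + 1)) k)).presheaf.stalk y) ≃+*
      HomogeneousLocalization.AtPrime (homogeneousSubmodule (Fin (n + 1)) k) y.asHomogeneousIdeal.toIdeal :=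
    Proj.stalkIso' (homogeneousSubmodule (Fin (n + 1)) k) y
  let g : Fin c → (Proj (homogeneousSubmodule (Fin (n + 1)) k)).presheaf.stalk y := fun l =>
    ((Proj (homogeneousSubmodule (Fin (n + 1)) k)).presheaf.germ
        (Proj.basicOpen (homogeneousSubmodule (Fin (n + 1)) k) (X i)) y hyi).hom
      ((Proj.awayToSection (homogeneousSubmodule (Fin (n + 1)) k) (X i)).hom
        (mk₁ (homogeneousSubmodule (Fin (n + 1)) k) (X_mem_one'' i) (d l) (f l) (hf l)))
  have hbg : ∑ l, b l * g l ∈ maximalIdeal ((Proj (homogeneousSubmodule (Fin (n + 1)) k)).presheaf.stalk y) ^ 2 := hb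
  have hXi : (X i : MvPolynomial (Fin (n + 1)) k) ∉ y.asHomogeneousIdeal.toIdeal := hyi
  have hXpow : ∀ l, (X i : MvPolynomial (Fin (n + 1)) k) ^ d l ∉ y.asHomogeneousIdeal.toIdeal :=
    fun l h => hXi (Ideal.IsPrime.mem_of_pow_mem inferInstance _ h)
  -- the core in `B = (k[x]_𝔮)₀`, for the images of the germs
  have core := downstairs_atPrime_of_jacobian f y.asHomogeneousIdeal.toIdeal hy e hdet (fun l => X i ^ d l) hXpow
    (fun l => ε (g l)) (fun l => val_stalkIso'_germ_awayToSection_mk₁ i y hyi (d l) (f l) (hf l)) (fun l => ε (b l)) ?_ l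
  · -- units back along `ε`
    rw [mem_maximalIdeal, mem_nonunits_iff] at core ⊢
    exact fun hu => core (hu.map ε)
  · -- `ε` maps `𝔪²` into `𝔪²`
    have hle : maximalIdeal ((Proj (homogeneousSubmodule (Fin (n + 1)) k)).presheaf.stalk y) ≤
        (maximalIdeal (HomogeneousLocalization.AtPrime (homogeneousSubmodule (Fin (n + 1)) k)
          y.asHomogeneousIdeal.toIdeal)).comap ε.toRingHom := by
      intro x hx
      rw [Ideal.mem_comap, mem_maximalIdeal, mem_nonunits_iff]
      rw [mem_maximalIdeal, mem_nonunits_iff] at hx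
      exact fun hu => hx ((MulEquiv.isUnit_map ε).mp hu)
    have h1 : ∑ l, b l * g l ∈ (maximalIdeal (HomogeneousLocalization.AtPrime (homogeneousSubmodule (Fin (n + 1)) k)
        y.asHomogeneousIdeal.toIdeal)).comap ε.toRingHom ^ 2 := Ideal.pow_right_mono hle 2 hbg
    have h2 : ∑ l, b l * g l ∈ (maximalIdeal (HomogeneousLocalization.AtPrime (homogeneousSubmodule (Fin (n + 1)) k)
        y.asHomogeneousIdeal.toIdeal) ^ 2).comap ε.toRingHom := Ideal.le_comap_pow _ 2 h1
    rw [Ideal.mem_comap] at h2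
    simpa [map_sum, map_mul] using h2

/-- **CI-JAC (J′), res-D-pv-027's interface verbatim (`∃` a chart).** Under the hypotheses of `downstairs_stalk_of_jacobian` there is
a chart `D₊(x_i) ∋ y` (the prime `𝔮_y` is relevant) on which (J′) holds. [cite: Matsumura1987, Thm. 30.4 (ii)] -/
theorem downstairs_of_jacobianMinor (f : Fin c → MvPolynomial (Fin (n + 1)) k) (d : Fin c → ℕ)
    (hf : ∀ l, f l ∈ homogeneousSubmodule (Fin (n + 1)) k (d l)) (y : Proj (homogeneousSubmodule (Fin (n + 1)) k))
    (hy : ∀ l, f l ∈ y.asHomogeneousIdeal)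
    (hjac : ∃ e : Fin c ↪ Fin (n + 1), (Matrix.of fun i j => pderiv (e j) (f i)).det ∉ y.asHomogeneousIdeal) :
    ∃ (i : Fin (n + 1)) (hyi : y ∈ Proj.basicOpen (homogeneousSubmodule (Fin (n + 1)) k) (X i)),
      ∀ b : Fin c → (Proj (homogeneousSubmodule (Fin (n + 1)) k)).presheaf.stalk y,
        ∑ l, b l * ((Proj (homogeneousSubmodule (Fin (n + 1)) k)).presheaf.germ
              (Proj.basicOpen (homogeneousSubmodule (Fin (n + 1)) k) (X i)) y hyi).hom
            ((Proj.awayToSection (homogeneousSubmodule (Fin (n + 1)) k) (X i)).hom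
              (mk₁ (homogeneousSubmodule (Fin (n + 1)) k) (X_mem_one'' i) (d l) (f l) (hf l))) ∈
          maximalIdeal ((Proj (homogeneousSubmodule (Fin (n + 1)) k)).presheaf.stalk y) ^ 2 →
        ∀ l, b l ∈ maximalIdeal ((Proj (homogeneousSubmodule (Fin (n + 1)) k)).presheaf.stalk y) := by
  -- some variable is not in the relevant prime `𝔮_y`
  have hrel : ∃ i : Fin (n + 1), (X i : MvPolynomial (Fin (n + 1)) k) ∉ y.asHomogeneousIdeal := by
    by_contra h
    simp only [not_exists, not_not] at h
    apply y.not_irrelevant_le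
    refine toIdeal_le_toIdeal_iff.mp ?_
    refine (Literature.AlgebraicGeometry.Motives.ProjectiveSpace.irrelevant_le_span (n := n) (k := k)).trans
      (Ideal.span_le.mpr ?_)
    rintro _ ⟨i, rfl⟩
    exact h i
  obtain ⟨i, hi⟩ := hrel
  exact ⟨i, hi, downstairs_stalk_of_jacobian f d hf y hy hjac i hi⟩

end Stalk

end CILift

end Summit.ResolutionOfSingularities.ResolutionOfSingularities.Cruxes.EquisingularLiftNat.Sections

end
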